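import Summits.BirchSwinnertonDyer.BirchSwinnertonDyer.Theorems.ClassRecordThreeEulerHalvesAtThreeCartanCarayolLift
import HarnessLib

/-!
# (PAR) Periods of a weight-two cusp form over parabolic elements vanish — the analytic input of the parabolic-null clause of (EIG′)

Helper file for crux `EulerHalvesAtThree` (stmt-BirchSwinnertonDyer-19109) ∕ node NUM `CartanOnePlaceDegreeLawAtThree` (24801), Galois leaf (OBS)
`CartanCover.Charext.NoModThreePeriodCharacterExtension`, socket `…CartanCarayolLift` r2 (p742701): (EIG′)
`CartanCarayol.PeriodCharacterCuspidalEigenPackageAtThree` asks the certificate's cochain `χ̄` to be NULL ON PARABOLIC ELEMENTS of `ι(O₀'¹) = coverUnits X q`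
(the clause that makes (LIFT′) `CuspidalEigenCochainLiftPrimeToCartanPlaceAtThree` true at `D = 1`; critic idea-crit-14 V214). This file PROVES the inputs of
that clause which are not Hecke theory:
* §1 ALGEBRA — a parabolic `g ∈ ι(O₀'¹)` has `g^{2q} ∈ Γ̄(q) = principalLevel X q` (`±g` is unipotent by Cayley–Hamilton, `(±g)^q = 1 + q(±g - 1)`), and the
  `gcd(2q, 3) = 1` bookkeeping in the literal currency of (OBS) («`∃ y ∈ Λ, · = 3y`»);
* §2 ANALYSIS — **(PAR)** `segmentIntegral_smul_eq_zero_of_isParabolic`: for ANY subgroup `Γ ≤ SL₂(ℝ)` (Mathlib `Subgroup.HasDetOne`), any `F ∈ S₂(Γ)`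
  (Mathlib `CuspForm Γ 2`) and any parabolic `β ∈ Γ`, `∫_z^{βz} F = 0` for every `z ∈ ℍ`. Proof: the period does not depend on `z` (`Γ`-invariance + Cauchy,
  tree `segmentIntegral_sub_segmentIntegral` ∕ `CartanDegree.segmentIntegral_slash_inv_smul`); moving `z = g·w` towards the cusp `c = g·∞` fixed by `β`
  (`IsCusp c Γ`, Mathlib), the period becomes `∫_w^{w+h} (F ∣[2] g)` over a horizontal segment at height `Im w`, and `F ∣[2] g → 0` at `i∞`
  (`CuspForm.zero_at_cusps'`), so its norm is `≤ ε·|h|` for every `ε > 0`. Vacuous when `Γ` is cocompact (`D > 1`: no parabolic elements).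
* §3 THE CLAUSE IN (OBS) CURRENCY — `exists_eq_three_mul_of_isParabolic`: under the three literal hypotheses of (OBS)∕(CONG)∕(EIG′) on `(c, χ)` («values in
  `Λ`», «additive mod `3Λ`», «`χ ≡ c·per_F (mod 3Λ)` on `Γ̄(q)`»), `q ∈ C` prime `≠ 3`: every parabolic `x ∈ coverUnits X q` has `χ x ∈ 3Λ`,
  i.e. `χ̄ x = 0` — exactly the parabolic conjunct of (EIG′) for the certificate's `χ̄ = χ mod 3Λ` (the LEAD converts with `InertHecke.redThree_eq_zero_iff`, part C).
HONEST: helper theorems only; no `Prop` is defined, no item is concluded; (EIG′)'s Hecke-eigen conjunct, (SIMREP) and (LIFT′) are untouched; 24801 ∕ 19109 stay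
open; no summit statement is proved; BSD is proved for no curve.
[cite: ShimuraIATAF1971, §8.2 (8.2.19)–(8.2.20) and §1.3–§1.5 (cusps, parabolic elements)] [cite: DiamondShurman2005, §5.2]
-/

set_option linter.dupNamespace false
set_option autoImplicit false

noncomputable section

open scoped Classical MatrixGroups UpperHalfPlane ModularForm

namespace Summit.BirchSwinnertonDyer.BirchSwinnertonDyer.Theorems.CartanCarayol

open Summit.BirchSwinnertonDyer.BirchSwinnertonDyer.Theorems
open Literature.NumberTheory.Automorphic UpperHalfPlane

/-! ## §1 Algebra: parabolic elements of the cover group, and the `gcd(2q,3) = 1` bookkeeping -/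

section Algebra

variable {D M : ℕ} {C : Finset ℕ}

/-- In any ring: if `(u - 1)² = 0` then `u ^ k = 1 + k • (u - 1)`. [folklore] -/
theorem pow_eq_one_add_nsmul_of_sq_eq_zero {R : Type*} [Ring R] (u : R) (hu : (u - 1) ^ 2 = 0) (k : ℕ) :
    u ^ k = 1 + k • (u - 1) := by
  induction k with
  | zero => simp
  | succ k ih =>
    have h1 : (u - 1) * u = u - 1 := by
      have : (u - 1) * u = (u - 1) ^ 2 + (u - 1) := by noncomm_ring
      rw [this, hu, zero_add]
    rw [pow_succ, ih, add_mul, one_mul, smul_mul_assoc, h1, add_smul, one_smul]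
    abel

/-- **unipotent elements of the cover group have `q`-th power in `Γ̄(q)`**: if `g = ι(x) ∈ ι(O₀'¹)` satisfies `(g - 1)² = 0` then
`x^q - 1 = q·(x - 1)`, so `g^q ∈ Γ̄(q)` (`CartanCover.principalLevel`). [folklore] -/
theorem pow_mem_principalLevel_of_sq_sub_one_eq_zero (X : CartanLevelCurveData D M C) (q : ℕ) {g : GL (Fin 2) ℝ}
    (hg : g ∈ CartanCover.coverUnits X q) (h1 : ((g : Matrix (Fin 2) (Fin 2) ℝ) - 1) ^ 2 = 0) :
    g ^ q ∈ CartanCover.principalLevel X q := by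
  have hg' := hg
  obtain ⟨⟨x, hx, hxg⟩, -, -⟩ := hg'
  have hO := CartanCover.isOrder_coverOrder X q
  have hxpow : ∀ k : ℕ, x ^ k ∈ CartanCover.coverOrder X q := fun k ↦ by
    induction k with
    | zero => rw [pow_zero]; exact hO.one_mem
    | succ k ih => rw [pow_succ]; exact hO.mul_mem _ ih _ hx
  have hx1 : (x - 1) ^ 2 = 0 := X.ι_injective (by rw [map_pow, map_sub, map_one, hxg, h1, map_zero])
  refine ⟨(CartanCover.coverUnits X q).pow_mem hg q, x ^ q, hxpow q, by rw [map_pow, hxg, Units.val_pow_eq_pow_val], x - 1,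
    (CartanCover.coverOrder X q).sub_mem hx hO.one_mem, ?_⟩
  rw [pow_eq_one_add_nsmul_of_sq_eq_zero x hx1 q, add_sub_cancel_left, natCast_zsmul]

/-- a parabolic matrix of determinant `1` over `ℝ` is `±`unipotent: `(m - 1)² = 0` or `(m + 1)² = 0` (Cayley–Hamilton; `tr m = ±2`). [folklore] -/
theorem sq_sub_one_eq_zero_or_of_isParabolic {m : Matrix (Fin 2) (Fin 2) ℝ} (hm : m.IsParabolic) (hdet : m.det = 1) :
    (m - 1) ^ 2 = 0 ∨ (m + 1) ^ 2 = 0 := by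
  have h0 := hm.sub_eigenvalue_sq_eq_zero
  have htr : m.trace ^ 2 = 2 ^ 2 := by
    have := hm.2
    rw [Matrix.discr_fin_two, hdet, sub_eq_zero] at this
    rw [this]; norm_num
  rcases (sq_eq_sq_iff_eq_or_eq_neg).mp htr with h | h
  · left
    simpa [Matrix.parabolicEigenvalue, h] using h0
  · right
    have h2 : m.parabolicEigenvalue = -1 := by rw [Matrix.parabolicEigenvalue, h]; norm_num
    rw [h2, map_neg, map_one, sub_neg_eq_add] at h0
    exact h0

/-- **parabolic elements of the cover group have their `2q`-th power in `Γ̄(q)`**: `g ∈ ι(O₀'¹)` parabolic ⇒ `±g` unipotent ⇒ `(±g)^q ∈ Γ̄(q)` ⇒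
`g^{2q} = ((±g)^q)² ∈ Γ̄(q)`. [folklore] -/
theorem pow_two_mul_mem_principalLevel_of_isParabolic (X : CartanLevelCurveData D M C) (q : ℕ) {g : GL (Fin 2) ℝ}
    (hg : g ∈ CartanCover.coverUnits X q) (hpar : Matrix.GeneralLinearGroup.IsParabolic g) :
    g ^ (2 * q) ∈ CartanCover.principalLevel X q := by
  have hdet : (g : Matrix (Fin 2) (Fin 2) ℝ).det = 1 := by
    rw [← Matrix.GeneralLinearGroup.val_det_apply, hg.2.2, Units.val_one]
  rcases sq_sub_one_eq_zero_or_of_isParabolic hpar hdet with h | h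
  · rw [mul_comm, pow_mul]
    exact (CartanCover.principalLevel X q).pow_mem (pow_mem_principalLevel_of_sq_sub_one_eq_zero X q hg h) 2
  · have hng : -g ∈ CartanCover.coverUnits X q := by
      have := (CartanCover.coverUnits X q).mul_mem (CartanCover.neg_one_mem_coverUnits X q) hg
      rwa [neg_one_mul] at this
    have h' : (((-g : GL (Fin 2) ℝ) : Matrix (Fin 2) (Fin 2) ℝ) - 1) ^ 2 = 0 := by
      rw [Units.val_neg, ← neg_add', neg_sq, h]
    have := (CartanCover.principalLevel X q).pow_mem (pow_mem_principalLevel_of_sq_sub_one_eq_zero X q hng h') 2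
    rwa [← pow_mul, Even.neg_pow ⟨q, (mul_two q).trans rfl⟩, mul_comm] at this

/-- **additivity mod `3Λ` along powers** in the literal currency of (OBS): if `χ(u·v) - χ u - χ v ∈ 3Λ` on a subgroup `U`, then
`χ(x^k) - k·χ(x) ∈ 3Λ` for `x ∈ U`. [folklore] -/
theorem exists_pow_sub_mul_eq_three_mul (Λ : Submodule ℤ ℂ) (U : Subgroup (GL (Fin 2) ℝ)) (χ : GL (Fin 2) ℝ → ℂ)
    (hadd : ∀ u ∈ U, ∀ v ∈ U, ∃ y ∈ Λ, χ (u * v) - χ u - χ v = 3 * y) {x : GL (Fin 2) ℝ} (hx : x ∈ U) (k : ℕ) :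
    ∃ y ∈ Λ, χ (x ^ k) - k * χ x = 3 * y := by
  induction k with
  | zero =>
    obtain ⟨y, hy, h⟩ := hadd 1 U.one_mem 1 U.one_mem
    refine ⟨-y, Λ.neg_mem hy, ?_⟩
    rw [pow_zero, Nat.cast_zero, zero_mul, sub_zero]
    rw [mul_one] at h
    linear_combination (-1 : ℂ) * h
  | succ k ih =>
    obtain ⟨y₁, hy₁, h₁⟩ := ih
    obtain ⟨y₂, hy₂, h₂⟩ := hadd (x ^ k) (U.pow_mem hx k) x hx
    refine ⟨y₁ + y₂, Λ.add_mem hy₁ hy₂, ?_⟩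
    rw [pow_succ, Nat.cast_succ]
    linear_combination h₁ + h₂

/-- **the `gcd(2q, 3) = 1` step** in (OBS) currency: if `χ x ∈ Λ` and `(2q)·χ x ∈ 3Λ` with `q` a prime `≠ 3`, then `χ x ∈ 3Λ`. [folklore] -/
theorem exists_eq_three_mul_of_two_mul_prime {Λ : Submodule ℤ ℂ} {q : ℕ} (hq : q.Prime) (hq3 : q ≠ 3) {a : ℂ} (ha : a ∈ Λ)
    (h2q : ∃ y ∈ Λ, (2 * q : ℕ) * a = 3 * y) : ∃ y ∈ Λ, a = 3 * y := by
  have hcop : Nat.Coprime (2 * q) 3 := by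
    refine Nat.Coprime.mul_left ?_ ?_
    · exact (Nat.coprime_primes Nat.prime_two Nat.prime_three).mpr (by decide)
    · exact (Nat.coprime_primes hq Nat.prime_three).mpr hq3
  obtain ⟨u, v, huv⟩ := (Nat.isCoprime_iff_coprime.mpr hcop)
  obtain ⟨y, hy, h⟩ := h2q
  refine ⟨u • y + v • a, Λ.add_mem (Λ.smul_mem u hy) (Λ.smul_mem v ha), ?_⟩
  have e : (u : ℂ) * ((2 * q : ℕ) : ℂ) + v * 3 = 1 := by exact_mod_cast huv
  rw [zsmul_eq_mul, zsmul_eq_mul]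
  linear_combination (-a) * e + (u : ℂ) * h

end Algebra

/-! ## §2 Analysis: (PAR) — the period of a cusp form over a parabolic element vanishes -/

section ParabolicPeriod

variable {Γ : Subgroup (GL (Fin 2) ℝ)}

/-- a straight segment at constant height `Im = Im z ≥ A`, where `‖s‖ ≤ ε` above height `A`, has `‖∫_z^w s‖ ≤ ε·|w - z|`. [folklore] -/
theorem norm_segmentIntegral_le_of_im_eq (s : ℍ → ℂ) {ε A : ℝ} (hs : ∀ u : ℍ, A ≤ u.im → ‖s u‖ ≤ ε) {z w : ℍ}
    (hzw : w.im = z.im) (hA : A ≤ z.im) : ‖segmentIntegral s z w‖ ≤ ε * ‖(w : ℂ) - z‖ := by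
  unfold segmentIntegral
  have hb := intervalIntegral.norm_integral_le_of_norm_le_const (a := (0 : ℝ)) (b := 1) (C := ε * ‖(w : ℂ) - z‖)
    (f := fun t : ℝ ↦ s (UpperHalfPlane.ofComplex ((1 - (t : ℂ)) * (z : ℂ) + (t : ℂ) * (w : ℂ))) * ((w : ℂ) - (z : ℂ))) ?_
  · simpa using hb
  · intro t _
    rw [norm_mul]
    refine mul_le_mul_of_nonneg_right (hs _ ?_) (norm_nonneg _)
    have him : ((1 - (t : ℂ)) * (z : ℂ) + (t : ℂ) * (w : ℂ)).im = z.im := by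
      simp only [Complex.add_im, Complex.mul_im, Complex.sub_re, Complex.one_re, Complex.ofReal_re, Complex.sub_im, Complex.one_im,
        Complex.ofReal_im, sub_zero, zero_mul, add_zero, UpperHalfPlane.coe_im, hzw]
      ring
    have hpos : 0 < ((1 - (t : ℂ)) * (z : ℂ) + (t : ℂ) * (w : ℂ)).im := by rw [him]; exact z.im_pos
    rw [UpperHalfPlane.ofComplex_apply_of_im_pos hpos, UpperHalfPlane.mk_im, him]
    exact hA

/-- every point of `ℙ¹(ℝ)` is `g·∞` for some `g ∈ SL₂(ℝ)`. [folklore] -/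
theorem exists_det_eq_one_smul_infty_eq (c : OnePoint ℝ) : ∃ g : GL (Fin 2) ℝ, g.det.val = 1 ∧ g • (OnePoint.infty : OnePoint ℝ) = c := by
  cases c with
  | infty => exact ⟨1, by rw [map_one, Units.val_one], one_smul _ _⟩
  | coe x =>
    have hA : (!![x, -1; 1, 0] : Matrix (Fin 2) (Fin 2) ℝ).det = 1 := by simp [Matrix.det_fin_two_of]
    refine ⟨Matrix.GeneralLinearGroup.mkOfDetNeZero !![x, -1; 1, 0] (by rw [hA]; exact one_ne_zero), ?_, ?_⟩
    · rw [Matrix.GeneralLinearGroup.val_det_apply, Matrix.GeneralLinearGroup.val_mkOfDetNeZero, hA]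
    · rw [OnePoint.smul_infty_eq_ite]
      simp [Matrix.GeneralLinearGroup.val_mkOfDetNeZero]

variable [Γ.HasDetOne]

/-- Elements of `Γ ≤ SL₂(ℝ)` have positive determinant.
-- adapted from Literature/NumberTheory/Automorphic/ShimuraCurvePeriodsHeckeIntegralityProofs.lean §2 (no hub olean in this closure) [folklore] -/
private theorem det_val_pos_of_mem_par {γ : GL (Fin 2) ℝ} (hγ : γ ∈ Γ) : 0 < γ.det.val := by
  rw [Subgroup.HasDetOne.det_eq hγ, Units.val_one]; exact one_pos

/-- `Γ`-invariance of segment integrals: `∫_{γz}^{γw} F = ∫_z^w F`.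
-- adapted from Literature/NumberTheory/Automorphic/ShimuraCurvePeriodsHeckeIntegralityProofs.lean §2 (no hub olean in this closure) [folklore] -/
private theorem segmentIntegral_smul_smul_par (F : CuspForm Γ 2) {γ : GL (Fin 2) ℝ} (hγ : γ ∈ Γ) (z w : ℍ) :
    segmentIntegral F (γ • z) (γ • w) = segmentIntegral F z w := by
  have e := CartanDegree.segmentIntegral_slash_inv_smul F (det_val_pos_of_mem_par hγ) (γ • z) w
  rw [SlashInvariantForm.slash_action_eqn F γ hγ, inv_smul_smul] at e
  exact e.symm

/-- The period `∫_z^{γz} F` does not depend on the base point `z` (`γ ∈ Γ`).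
-- adapted from Literature/NumberTheory/Automorphic/ShimuraCurvePeriodsHeckeIntegralityProofs.lean §2 (no hub olean in this closure) [folklore] -/
private theorem period_eq_period_par (F : CuspForm Γ 2) {γ : GL (Fin 2) ℝ} (hγ : γ ∈ Γ) (z w : ℍ) :
    segmentIntegral F z (γ • z) = segmentIntegral F w (γ • w) := by
  have e1 := segmentIntegral_sub_segmentIntegral F w z (γ • z)
  have e2 := segmentIntegral_sub_segmentIntegral F w (γ • w) (γ • z)
  have e3 := segmentIntegral_smul_smul_par F hγ w z
  linear_combination (-1 : ℂ) * e1 + e2 + e3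

/-- **(PAR) PERIODS OVER PARABOLIC ELEMENTS VANISH.** For `Γ ≤ SL₂(ℝ)`, `F ∈ S₂(Γ)` (Mathlib `CuspForm Γ 2`: holomorphic, `Γ`-invariant of weight `2`, zero at
every cusp of `Γ`) and a parabolic `β ∈ Γ`: `∫_z^{βz} F(τ) dτ = 0` for every `z ∈ ℍ`. (`β` fixes the cusp `c = g·∞`; the period is independent of `z`; at
`z = g·w` it equals `∫_w^{β'w} (F ∣[2] g)` with `β' = g⁻¹βg` a translation `w ↦ w + h`; `F ∣[2] g → 0` as `Im w → ∞`, so the period has norm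
`≤ ε|h|` for all `ε > 0`.) In the language of cohomology: the period cocycle of a cusp form is PARABOLIC (a class in Shimura's `H¹_P`).
[cite: ShimuraIATAF1971, §8.2 (8.2.19)–(8.2.20)] -/
theorem segmentIntegral_smul_eq_zero_of_isParabolic (F : CuspForm Γ 2) {β : GL (Fin 2) ℝ} (hβ : β ∈ Γ)
    (hpar : Matrix.GeneralLinearGroup.IsParabolic β) (z : ℍ) : segmentIntegral F z (β • z) = 0 := by
  -- the cusp fixed by `β` and a matrix `g ∈ SL₂(ℝ)` moving `∞` to it
  set c : OnePoint ℝ := Matrix.GeneralLinearGroup.parabolicFixedPoint β with hc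
  have hβc : β • c = c := hpar.smul_eq_self_iff.mpr rfl
  have hcusp : IsCusp c Γ := ⟨β, hβ, hpar, hβc⟩
  obtain ⟨g, hgdet, hgc⟩ := exists_det_eq_one_smul_infty_eq c
  have hg : 0 < g.det.val := by rw [hgdet]; exact one_pos
  -- `β' = g⁻¹ β g` fixes `∞`, is parabolic with determinant `1`: an upper-triangular `±`translation
  set β' : GL (Fin 2) ℝ := g⁻¹ * β * g with hβ'
  have hβ'inf : β' • (OnePoint.infty : OnePoint ℝ) = OnePoint.infty := by
    rw [hβ', mul_smul, mul_smul, hgc, hβc, ← hgc, inv_smul_smul]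
  have h10 : β' 1 0 = 0 := OnePoint.smul_infty_eq_self_iff.mp hβ'inf
  have hpar' : Matrix.GeneralLinearGroup.IsParabolic β' := (Matrix.GeneralLinearGroup.isParabolic_conj_iff' g β).mpr hpar
  obtain ⟨h00, h01⟩ := (Matrix.GeneralLinearGroup.isParabolic_iff_of_upperTriangular h10).mp hpar'
  have hdet' : β'.det.val = 1 := by
    rw [hβ', map_mul, map_mul, map_inv, Subgroup.HasDetOne.det_eq hβ, mul_one, inv_mul_cancel, Units.val_one]
  have hdet'pos : 0 < β'.det.val := by rw [hdet']; exact one_pos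
  have h11 : β' 1 1 ≠ 0 := by
    intro h
    have : β'.det.val = 0 := by
      rw [Matrix.GeneralLinearGroup.val_det_apply, Matrix.det_fin_two, h10, h, mul_zero, mul_zero, sub_zero]
    rw [hdet'] at this
    exact one_ne_zero this
  -- `β'` acts on `ℍ` as the real translation by `h = β' 0 1 / β' 1 1`
  have htrans : ∀ w : ℍ, ((β' • w : ℍ) : ℂ) = (w : ℂ) + ((β' 0 1 / β' 1 1 : ℝ) : ℂ) := by
    intro w
    have h11' : ((β' 1 1 : ℝ) : ℂ) ≠ 0 := Complex.ofReal_ne_zero.mpr h11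
    rw [UpperHalfPlane.coe_smul_of_det_pos hdet'pos, UpperHalfPlane.num, UpperHalfPlane.denom, h10, h00, Complex.ofReal_zero, zero_mul,
      zero_add, Complex.ofReal_div, add_div, mul_div_cancel_left₀ _ h11']
  have him : ∀ w : ℍ, (β' • w).im = w.im := fun w ↦ by
    rw [← UpperHalfPlane.coe_im, htrans, Complex.add_im, Complex.ofReal_im, add_zero, UpperHalfPlane.coe_im]
  -- the period, moved to the cusp: `∫_z^{βz} F = ∫_w^{β'w} (F ∣[2] g)` for every `w`
  have hper : ∀ w : ℍ, segmentIntegral F z (β • z) = segmentIntegral (⇑F ∣[(2 : ℤ)] g) w (β' • w) := by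
    intro w
    have hgβ : g * β' = β * g := by rw [hβ', ← mul_assoc, ← mul_assoc, mul_inv_cancel, one_mul]
    have hsm : g • β' • w = β • g • w := by rw [smul_smul, hgβ, ← smul_smul]
    have e := CartanDegree.segmentIntegral_slash_inv_smul F hg (g • w) (β' • w)
    rw [inv_smul_smul, hsm] at e
    rw [period_eq_period_par F hβ z (g • w), e]
  -- `F ∣[2] g → 0` at `i∞` because `c = g·∞` is a cusp of `Γ`
  have hzero : UpperHalfPlane.IsZeroAtImInfty (⇑F ∣[(2 : ℤ)] g) := CuspForm.zero_at_cusps' F hcusp g hgc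
  rw [UpperHalfPlane.isZeroAtImInfty_iff] at hzero
  -- the estimate `‖period‖ ≤ ε·|h|` for every `ε > 0`
  have hbound : ∀ ε : ℝ, 0 < ε → ‖segmentIntegral F z (β • z)‖ ≤ ε * |β' 0 1 / β' 1 1| := by
    intro ε hε
    obtain ⟨A, hA⟩ := hzero ε hε
    have hI : (Complex.I * ((max A 1 : ℝ) : ℂ)).im = max A 1 := by simp
    set w : ℍ := ⟨Complex.I * ((max A 1 : ℝ) : ℂ), by rw [hI]; exact lt_max_of_lt_right one_pos⟩ with hw
    have hwA : A ≤ w.im := by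
      rw [hw, UpperHalfPlane.mk_im, hI]
      exact le_max_left A 1
    rw [hper w]
    have hb := norm_segmentIntegral_le_of_im_eq (⇑F ∣[(2 : ℤ)] g) hA (him w) hwA
    rwa [htrans w, add_sub_cancel_left, Complex.norm_real, Real.norm_eq_abs] at hb
  -- conclude
  by_contra hne
  have hpos : 0 < ‖segmentIntegral F z (β • z)‖ := norm_pos_iff.mpr hne
  have hK : 0 ≤ |β' 0 1 / β' 1 1| := abs_nonneg _
  have hb := hbound (‖segmentIntegral F z (β • z)‖ / (2 * (|β' 0 1 / β' 1 1| + 1))) (by positivity)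
  have hlt : ‖segmentIntegral F z (β • z)‖ / (2 * (|β' 0 1 / β' 1 1| + 1)) * |β' 0 1 / β' 1 1| <
      ‖segmentIntegral F z (β • z)‖ := by
    rw [div_mul_eq_mul_div, div_lt_iff₀ (by positivity)]
    nlinarith
  exact absurd hb (not_le.mpr hlt)

end ParabolicPeriod

/-! ## §3 The parabolic-null clause of (EIG′) in the currency of (OBS) -/

section Clause

variable {D M : ℕ} {C : Finset ℕ}

/-- **THE PARABOLIC-NULL CLAUSE, (OBS) CURRENCY.** Let `X` be Cartan-level Shimura-curve data, `q ∈ C` a prime `≠ 3`, `Q` Shimura-parametrisation data on `X`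
(period lattice `Λ = Q.L.lattice`, cusp form `F = Q.form ∈ S₂(Γ)`, base point `z₀`), `c ∈ ℂ`, and `χ : GL₂(ℝ) → ℂ` with the three literal hypotheses of
(OBS) ∕ (CONG) ∕ (EIG′): values in `Λ` on `ι(O₀'¹) = coverUnits X q`, additive modulo `3Λ` there, and `χ ≡ c·∫_{z₀}^{β z₀} F (mod 3Λ)` on
`Γ̄(q) = principalLevel X q`. THEN `χ x ∈ 3Λ` for every PARABOLIC `x ∈ coverUnits X q` — i.e. the reduced cochain `χ̄ = χ mod 3Λ` is null on parabolic
elements, the new conjunct of (EIG′) `PeriodCharacterCuspidalEigenPackageAtThree`. Proof: `x^{2q} ∈ Γ̄(q)` (§1) is parabolic and lies in `Γ`, so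
`c·∫_{z₀}^{x^{2q} z₀} F = 0` by (PAR) and `χ(x^{2q}) ∈ 3Λ`; additivity gives `2q·χ(x) ∈ 3Λ`, and `gcd(2q, 3) = 1`. [folklore] -/
theorem exists_eq_three_mul_of_isParabolic (X : CartanLevelCurveData D M C) {q : ℕ} [Fact q.Prime] (hq : q ∈ C) (hq3 : q ≠ 3)
    {W₁ : WeierstrassCurve ℚ} [W₁.IsElliptic] (Q : CartanParametrizationData X W₁) (c : ℂ) (χ : GL (Fin 2) ℝ → ℂ)
    (hΛ : ∀ γ ∈ CartanCover.coverUnits X q, χ γ ∈ Q.L.lattice)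
    (hadd : ∀ γ ∈ CartanCover.coverUnits X q, ∀ δ ∈ CartanCover.coverUnits X q, ∃ y ∈ Q.L.lattice, χ (γ * δ) - χ γ - χ δ = 3 * y)
    (hres : ∀ β ∈ CartanCover.principalLevel X q,
      ∃ y ∈ Q.L.lattice, χ β - c * segmentIntegral (⇑Q.form) Q.basePoint (β • Q.basePoint) = 3 * y)
    {x : GL (Fin 2) ℝ} (hx : x ∈ CartanCover.coverUnits X q) (hpar : Matrix.GeneralLinearGroup.IsParabolic x) :
    ∃ y ∈ Q.L.lattice, χ x = 3 * y := by
  have hq0 : q ≠ 0 := (Fact.out : q.Prime).ne_zero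
  have hmem : x ^ (2 * q) ∈ CartanCover.principalLevel X q := pow_two_mul_mem_principalLevel_of_isParabolic X q hx hpar
  have hparpow : Matrix.GeneralLinearGroup.IsParabolic (x ^ (2 * q)) := hpar.pow (by omega)
  have hper : segmentIntegral (⇑Q.form) Q.basePoint ((x ^ (2 * q)) • Q.basePoint) = 0 :=
    segmentIntegral_smul_eq_zero_of_isParabolic Q.form (CartanCover.principalLevel_le_Gamma X q hq hmem) hparpow Q.basePoint
  obtain ⟨y₁, hy₁, h₁⟩ := hres _ hmem
  rw [hper, mul_zero, sub_zero] at h₁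
  obtain ⟨y₂, hy₂, h₂⟩ := exists_pow_sub_mul_eq_three_mul Q.L.lattice (CartanCover.coverUnits X q) χ hadd hx (2 * q)
  refine exists_eq_three_mul_of_two_mul_prime (Fact.out : q.Prime) hq3 (hΛ x hx) ⟨y₁ - y₂, Q.L.lattice.sub_mem hy₁ hy₂, ?_⟩
  linear_combination h₁ - h₂

end Clause

end Summit.BirchSwinnertonDyer.BirchSwinnertonDyer.Theorems.CartanCarayol

end
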